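import Mathlib
import Summits.Ventures.HodgeRepro2.T6NAut2
import Summits.Ventures.HodgeRepro2.T6N2Main

/-!
# T6N2Contract — sub-step N2 in the M2 composition shape over the lead's `NAut2` (owner t6-p5)

The v2 composition carrier `NAut2 F P` (T6NAut2, lead) carries N2's datum as the field
`d2 : N2Datum F P d3` and defines `AdmDatum := d2.Adm`; `periodInputN_of_mains₂` consumes
`hN2 : M.AdmDatum` (TARGET-T6 §9.3 «`N2_main … : M.AdmDatum`», the lead's l. 5136 (2)). This file
is that wrapper: `N2_main` = `N2Main.adm_of` on `M.d2`. Its binders are the ONE display of N2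
(`Hyp.Shimura2008_Thm2_2_i K`, Landherr's classification as printed in Shimura 2008 Thm 2.2(i),
class 0) and the (N0.3)(b) properties of the datum (`hfr`: `τ` is a CM frame; `h₁₁₁`, `h₁₀₀`: the
generating sign elements are μ-admissible for their vertex types; `hu`: the similitude scalar has
the sign pattern `(+, −, +)`) — class EX (existence of the datum), or 0 when the composition's `d2`
is built by `N2Main.ofSpec` (then `N2_main_ofSpec`: the display is the only binder). No new display,
no new datum, no new mathematics.

README §8(d): uses an L-value-free non-vanishing device: NO (TIER5 §N2, a pre-02:16Z line of
record — N2 asserts no non-vanishing — continued).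
-/

namespace Summit.Ventures.HodgeRepro2.T6.N2Contract

open Summit.Ventures.HodgeRepro2
open Summit.Ventures.HodgeRepro2.T6
open Summit.Ventures.HodgeRepro2.T5DatumSimilitude
open Summit.Ventures.HodgeRepro2.T5CubeTypes

variable {K : Type*} [Field K] [NumberField K] [NumberField.IsCMField K]

/-- `N2_main` over the M2 carrier (TARGET-T6 §9.3): N2's datum-level conclusion `M.AdmDatum` —
μ-admissibility of the four `ε_i`, `W_B ≅ W_A`, (H_χ) — from the display and the datum's (N0.3)(b)
properties. Consumed by name as `hN2` in `periodInputN_of_mains₂`. -/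
theorem N2_main {F : FaceSetting K} {P : NDatum F} (M : NAut2 F P)
    (hfr : IsCMFrame M.d2.τ)
    (h₁₁₁ : IsLiuSignElement K (M.d2.type t111) M.d2.e₁₁₁)
    (h₁₀₀ : IsLiuSignElement K (M.d2.type t100) M.d2.e₁₀₀)
    -- [residual: EX; the similitude scalar of (N0.3)(b), signs (+, −, +) — p3's `lemma_N2_datum`]
    (hu : N2Main.USpec M.d2)
    (hSh : Hyp.Shimura2008_Thm2_2_i K) : M.AdmDatum :=
  N2Main.adm_of M.d2 hfr h₁₁₁ h₁₀₀ hu hSh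

/-- `N2_main` when the carrier's `d2` is the explicit datum `N2Main.ofSpec` (Lemma N.2's
construction): the display is the only binder. -/
theorem N2_main_ofSpec {F : FaceSetting K} {P : NDatum F} (M : NAut2 F P)
    {τ : Fin 3 → (K →+* ℂ)} (hfr : IsCMFrame τ) {e₁₁₁ e₁₀₀ : K}
    (h₁₁₁ : IsLiuSignElement K (cubeType τ t111) e₁₁₁)
    (h₁₀₀ : IsLiuSignElement K (cubeType τ t100) e₁₀₀)
    (Char : Type) [CommGroup Char] (χ₁₁₁ χ₁₀₀ : Char)
    (admA : Set M.d3.A.Sa) (admB : Set M.d3.A.Sb) (admC : Set M.d3.B.Sa) (admD : Set M.d3.B.Sb)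
    (hd2 : M.d2 = N2Main.ofSpec F P M.d3 hfr h₁₁₁ h₁₀₀ Char χ₁₁₁ χ₁₀₀ admA admB admC admD)
    (hSh : Hyp.Shimura2008_Thm2_2_i K) : M.AdmDatum := by
  show M.d2.Adm
  rw [hd2]
  exact N2Main.ofSpec_adm F P M.d3 hfr h₁₁₁ h₁₀₀ Char χ₁₁₁ χ₁₀₀ admA admB admC admD hSh

end Summit.Ventures.HodgeRepro2.T6.N2Contract
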